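import Literature.AnabelianGeometry.SemiGraphs.TemperedVerticialInjective
import HarnessLib

/-!
# [SemiAnbd] §3: the vertex groups of a Galois-countable, quasi-coherent semi-graph of anabelioids
# are second countable — proofs

Mochizuki, *Semi-graphs of anabelioids*, Publ. RIMS **42** (2006), §3, with the author's erratum
[IUTchI] Rmk. 2.5.3 (i)–(ii): in [SemiAnbd] 3.5–3.9 "one must assume" Galois-countability
((T2), `ProfiniteSemiGraph.IsGaloisCountable`), and the tempered groups entering Proposition 3.2 are
Galois-countable, i.e. second countable (the hypothesis `[SecondCountableTopology]` of the tree's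
`GCConnectedTemperoids` / `TemperoidHomEqRes`). [cite: Mochizuki2012, IUTchI Rmk 2.5.3 (i)(ii), p. 52]

To apply Proposition 3.2 to `G_v^⊤ = B^temp(Π_v)` — as Theorem 3.7 (i) does ("a natural continuous
… outer homomorphism `π̂₁(G_v) → π₁^temp(G)`", i.e. the morphism of temperoids `B^temp(G) → G_v^⊤`
comes from a homomorphism `Π_v → π₁^temp(G)`) — one needs `Π_v` second countable, which the local
presentation `ProfiniteSemiGraph` does not record. It FOLLOWS from the hypotheses of
Proposition 3.6: by quasi-coherence every open subgroup `U ⊆ Π_v` dominates the kernel of some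
approximator `Π_v → Π'_v` (`exists_approximator_ker_le`, the step of the proof of Prop. 2.5 (i),
p. 27), whose trivialising covering (`Approximator.trivCov`) is a finite étale covering of `G`, hence
split by one of the countably many `G_i` of (T2); so the kernels `K_i` of `Π_v` on the `v`-fibres of
the `G_i` form a countable basis of neighbourhoods of `1` by open subgroups of finite index
(`exists_countable_openSubgroup_basis`), and their cosets a countable basis of the topology
(`secondCountableTopology_Gv`). [cite: MochizukiSemiAnbd2006, Prop 3.6 p.38]
-/

open CategoryTheory Topology Filter

namespace Literature.AnabelianGeometry.SemiGraphs

namespace ProfiniteSemiGraph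

universe u

variable {𝒢 : ProfiniteSemiGraph.{u}}

/-- **Quasi-coherence bounds kernels** (the step of the proof of Prop. 2.5 (i), p. 27, in the local
presentation): for every open subgroup `U ⊆ Π_v` there is an approximator `G → G'` (Def. 2.3 (ii))
with `Ker(Π_v → Π'_v) ⊆ U` — apply Def. 2.3 (iii) to the finite covering `Π_v/U` of `G_v` (and the
one-point coverings of the other constituents). [cite: MochizukiSemiAnbd2006, Prop 2.5 p.27] -/
theorem exists_approximator_ker_le (h𝒢 : 𝒢.IsQuasiCoherent) (v : 𝒢.graph.Vertex)
    (U : Subgroup (𝒢.Gv v)) (hU : IsOpen (U : Set (𝒢.Gv v))) :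
    ∃ A : 𝒢.Approximator, ∀ x : 𝒢.Gv v, A.πV v x = 1 → x ∈ U := by
  classical
  -- the finite coverings `Π_w/N_w`: `N_v = U`, `N_w = Π_w` otherwise
  let N : ∀ w : 𝒢.graph.Vertex, Subgroup (𝒢.Gv w) :=
    Function.update (fun w => (⊤ : Subgroup (𝒢.Gv w))) v U
  have hNv : N v = U := by
    simp only [N, Function.update_self]
  have hNw : ∀ w, w ≠ v → N w = ⊤ := fun w hw => by
    simp only [N, Function.update_of_ne hw]
  have hNopen : ∀ w, IsOpen (N w : Set (𝒢.Gv w)) := by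
    intro w
    by_cases hw : w = v
    · subst hw
      rw [hNv]
      exact hU
    · rw [hNw w hw, Subgroup.coe_top]
      exact isOpen_univ
  let HV : ∀ w, BTemp (𝒢.Gv w) := fun w =>
    ⟨Action.ofMulAction (𝒢.Gv w) (𝒢.Gv w ⧸ N w),
      (temperedAction_quotient_iff IsTempered.of_profinite (N w)).mpr (hNopen w)⟩
  let HE : ∀ e, BTemp (𝒢.Ge e) := fun e =>
    ⟨Action.ofMulAction (𝒢.Ge e) (𝒢.Ge e ⧸ (⊤ : Subgroup (𝒢.Ge e))),
      (temperedAction_quotient_iff IsTempered.of_profinite ⊤).mpr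
        (by rw [Subgroup.coe_top]; exact isOpen_univ)⟩
  haveI hfinU : Finite (𝒢.Gv v ⧸ U) := Subgroup.quotient_finite_of_isOpen _ hU
  have hM1 : 1 ≤ Nat.card (𝒢.Gv v ⧸ U) := Nat.card_pos
  have hV : ∀ w, Nat.card (HV w).obj.V ≤ Nat.card (𝒢.Gv v ⧸ U) ∧ Finite (HV w).obj.V := by
    intro w
    change Nat.card (𝒢.Gv w ⧸ N w) ≤ _ ∧ Finite (𝒢.Gv w ⧸ N w)
    by_cases hw : w = v
    · subst hw
      rw [hNv]
      exact ⟨le_rfl, hfinU⟩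
    · rw [hNw w hw]
      haveI : Subsingleton (𝒢.Gv w ⧸ (⊤ : Subgroup (𝒢.Gv w))) :=
        QuotientGroup.subsingleton_quotient_top
      exact ⟨(Finite.card_le_one_iff_subsingleton.mpr inferInstance).trans hM1, inferInstance⟩
  have hE : ∀ e, Nat.card (HE e).obj.V ≤ Nat.card (𝒢.Gv v ⧸ U) ∧ Finite (HE e).obj.V := by
    intro e
    haveI : Subsingleton (𝒢.Ge e ⧸ (⊤ : Subgroup (𝒢.Ge e))) :=
      QuotientGroup.subsingleton_quotient_top
    change Nat.card (𝒢.Ge e ⧸ (⊤ : Subgroup (𝒢.Ge e))) ≤ _ ∧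
      Finite (𝒢.Ge e ⧸ (⊤ : Subgroup (𝒢.Ge e)))
    exact ⟨(Finite.card_le_one_iff_subsingleton.mpr inferInstance).trans hM1, inferInstance⟩
  obtain ⟨A, hAV, -⟩ := h𝒢 _ HV HE hV hE
  refine ⟨A, fun x hx => ?_⟩
  have h1 := hAV v x hx ((1 : 𝒢.Gv v) : 𝒢.Gv v ⧸ N v)
  change x • ((1 : 𝒢.Gv v) : 𝒢.Gv v ⧸ N v) = ((1 : 𝒢.Gv v) : 𝒢.Gv v ⧸ N v) at h1
  rw [MulAction.Quotient.smul_mk, smul_eq_mul, mul_one, QuotientGroup.eq, mul_one,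
    inv_mem_iff, hNv] at h1
  exact h1

/-- **A countable basis of open subgroups of `Π_v`** ([IUTchI] Rmk. 2.5.3 (i)(T2) applied to
[SemiAnbd] Prop. 3.6's `G`): for `G` Galois-countable and quasi-coherent there are countably many
open subgroups `K_i ⊆ Π_v` — the kernels of `Π_v` on the `v`-fibres of the countable splitting
family `{G_i}` — such that every neighbourhood of `1` contains some `K_i` (an open normal `U`
dominates the kernel of an approximator, whose trivialising covering is split by some `G_i`, whence
`K_i ⊆ U`). [cite: Mochizuki2012, IUTchI Rmk 2.5.3 (i) (T2), p. 52] -/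
theorem exists_countable_openSubgroup_basis (hqc : 𝒢.IsQuasiCoherent)
    (hgc : 𝒢.IsGaloisCountable) (v : 𝒢.graph.Vertex) :
    ∃ K : ℕ → Subgroup (𝒢.Gv v), (∀ i, IsOpen (K i : Set (𝒢.Gv v))) ∧
      ∀ O ∈ 𝓝 (1 : 𝒢.Gv v), ∃ i, (K i : Set (𝒢.Gv v)) ⊆ O := by
  classical
  obtain ⟨-, F, hF, hsplit⟩ := hgc
  -- the kernel of `Π_v` on the `v`-fibre of `G_i`
  refine ⟨fun i =>
    { carrier := {g | ∀ x : ((F i).SV v).obj.V, ((F i).SV v).obj.ρ g x = x}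
      one_mem' := fun x => by
        rw [map_one]
        rfl
      mul_mem' := fun {a b} ha hb x => by
        rw [map_mul]
        change ((F i).SV v).obj.ρ a (((F i).SV v).obj.ρ b x) = x
        rw [hb x, ha x]
      inv_mem' := fun {a} ha x => by
        have h := congrArg (((F i).SV v).obj.ρ a⁻¹) (ha x)
        change (((F i).SV v).obj.ρ a⁻¹ * ((F i).SV v).obj.ρ a) x = _ at h
        rw [← map_mul, inv_mul_cancel, map_one] at h
        exact h.symm }, fun i => ?_, fun O hO => ?_⟩
  · -- open: a finite intersection of open stabilisers
    haveI : Finite ((F i).SV v).obj.V := (hF i).1.finite_V v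
    have : ({g | ∀ x : ((F i).SV v).obj.V, ((F i).SV v).obj.ρ g x = x} : Set (𝒢.Gv v)) =
        ⋂ x, {g | ((F i).SV v).obj.ρ g x = x} := by
      ext g
      simp only [Set.mem_setOf_eq, Set.mem_iInter]
    change IsOpen ({g | ∀ x : ((F i).SV v).obj.V, ((F i).SV v).obj.ρ g x = x} : Set (𝒢.Gv v))
    rw [this]
    exact isOpen_iInter_of_finite fun x => ((F i).SV v).property.2 x
  · -- every neighbourhood of `1` contains some `K_i`
    obtain ⟨O', hO'O, hO'open, hO'1⟩ := mem_nhds_iff.mp hO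
    obtain ⟨U, hUO'⟩ := ProfiniteGrp.exist_openNormalSubgroup_sub_open_nhds_of_one hO'open hO'1
    obtain ⟨A, hA⟩ := exists_approximator_ker_le hqc v U.toSubgroup U.isOpen
    obtain ⟨M, hM, hdvd⟩ := A.bounded
    obtain ⟨i, hiV, -⟩ := hsplit (A.trivCov hM hdvd) (A.trivCov_isFinite hM hdvd)
    refine ⟨i, fun g hg => hO'O (hUO' (hA g ?_))⟩
    obtain ⟨x₀⟩ := (hF i).2.nonempty_V v
    have hfix := hiV v x₀ g (hg x₀)
      (((1 : A.FV v), (⟨0, lt_max_of_lt_left Nat.one_pos⟩ : Fin (A.multV M v))) :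
        A.FV v × Fin (A.multV M v))
    have h2 := congrArg Prod.fst hfix
    change A.πV v g * 1 = 1 at h2
    rwa [mul_one] at h2

/-- **`Π_v` is second countable** for `G` Galois-countable and quasi-coherent (so that
Proposition 3.2, as amended by [IUTchI] Rmk. 2.5.3 (ii) (E7), applies to `G_v^⊤ = B^temp(Π_v)` in
Theorem 3.7 (i)): the cosets of the countably many finite-index open subgroups `K_i` form a countable
basis of the topology. [cite: Mochizuki2012, IUTchI Rmk 2.5.3 (ii) (E7), p. 52] -/
theorem secondCountableTopology_Gv (hqc : 𝒢.IsQuasiCoherent) (hgc : 𝒢.IsGaloisCountable)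
    (v : 𝒢.graph.Vertex) : SecondCountableTopology (𝒢.Gv v) := by
  classical
  obtain ⟨K, hKopen, hKbasis⟩ := exists_countable_openSubgroup_basis hqc hgc v
  -- the countable family of all cosets `gK_i`
  let b : Set (Set (𝒢.Gv v)) :=
    ⋃ i, Set.range fun q : 𝒢.Gv v ⧸ K i => (QuotientGroup.mk ⁻¹' {q} : Set (𝒢.Gv v))
  have hbc : b.Countable := by
    refine Set.countable_iUnion fun i => ?_
    haveI : Finite (𝒢.Gv v ⧸ K i) := Subgroup.quotient_finite_of_isOpen _ (hKopen i)
    exact Set.countable_range _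
  refine TopologicalSpace.IsTopologicalBasis.secondCountableTopology ?_ hbc
  refine TopologicalSpace.isTopologicalBasis_of_isOpen_of_nhds ?_ ?_
  · rintro O ⟨S, ⟨i, rfl⟩, ⟨q, rfl⟩⟩
    haveI : DiscreteTopology (𝒢.Gv v ⧸ K i) := QuotientGroup.discreteTopology (hKopen i)
    exact (isOpen_discrete {q}).preimage QuotientGroup.continuous_mk
  · intro a O haO hOopen
    have h1 : (fun x => a * x) ⁻¹' O ∈ 𝓝 (1 : 𝒢.Gv v) :=
      (hOopen.preimage (continuous_const_mul a)).mem_nhds (by simpa using haO)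
    obtain ⟨i, hi⟩ := hKbasis _ h1
    refine ⟨QuotientGroup.mk ⁻¹' {(a : 𝒢.Gv v ⧸ K i)}, ⟨_, ⟨i, rfl⟩, ⟨(a : 𝒢.Gv v ⧸ K i), rfl⟩⟩,
      rfl, fun x hx => ?_⟩
    have hx' : (x : 𝒢.Gv v ⧸ K i) = (a : 𝒢.Gv v ⧸ K i) := hx
    rw [QuotientGroup.eq] at hx'
    have hmem : a⁻¹ * x ∈ K i := by
      have := (K i).inv_mem hx'
      rwa [mul_inv_rev, inv_inv] at this
    have := hi hmem
    simpa using this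

/-- The edge groups of edges with an abutting branch are second countable, too (`b_* : Π_e ↪ Π_v`
is a closed embedding for `G` of injective type). [cite: Mochizuki2012, IUTchI Rmk 2.5.3 (ii) (E7), p. 52] -/
theorem secondCountableTopology_Ge (hqc : 𝒢.IsQuasiCoherent) (hgc : 𝒢.IsGaloisCountable)
    (hinj : 𝒢.IsOfInjectiveType) (b : 𝒢.graph.Branch) (v : 𝒢.graph.Vertex)
    (h : 𝒢.graph.abuts b = some v) : SecondCountableTopology (𝒢.Ge (𝒢.graph.edgeOf b)) := by
  haveI := secondCountableTopology_Gv hqc hgc v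
  haveI : T2Space (𝒢.Gv v) := inferInstance
  exact ((𝒢.brHom b v h).continuous.isClosedEmbedding (hinj b v h)).secondCountableTopology

end ProfiniteSemiGraph

end Literature.AnabelianGeometry.SemiGraphs
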